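import Literature.AlgebraicTopology.CharacteristicClasses.LineEulerNumberLocalization
import Literature.AlgebraicTopology.SingularHomology.CohomologyOfPoint
import HarnessLib

/-!
# The local index of a section of a complex line bundle, read in a trivialisation

D. McDuff, D. Salamon, *Introduction to Symplectic Topology*, 3rd ed. (2017), §2.7, proof of
Thm. 2.7.5: for a section `s : Σ → E` of a complex line bundle over a closed oriented surface that is
transverse to the zero section, "the first Chern number is the sum of the indices of the zeros of
`s`", the index of a zero `p` being the LOCAL DEGREE of `s` read in a trivialisation near `p`, i.e. of
the map `(U, U ∖ p) → (ℂ, ℂ ∖ 0)`; J. Milnor, J. Stasheff, *Characteristic Classes* (1974), §9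
(Thm. 9.1: the Thom class restricts on each fibre pair `(F, F₀)` to the preferred generator `u|(F, F₀)`)
and §10 (Thm. 10.2, 10.4: over a trivialising set the Thom class is the pull-back of the generator of
the fibre pair along the projection); A. Hatcher, *Algebraic Topology* (2002), §3.1 pp. 199–202
(naturality of relative classes and of the Kronecker pairing, homotopy invariance).

The prequel `LineEulerNumberLocalization` proved `⟨e(λ)(m), [S]_μ⟩ = Σ_{p ∈ Z(s)} ind_p(s)` with the
local index `ind_p(s) = ⟨(ŝ|_{U_p})^* t̃, μ_p⟩` defined through the relative Thom class
`t̃ ∈ H²(D, D ∖ s₀(B))` of the projective completion `D = P(λ ⊕ ℂ)`.  This file identifies `ind_p(s)`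
with the pairing computed in a TRIVIALISATION, in the fixed model pair `(ℂ, ℂ ∖ 0)` (the tree's fixed
line `ULift ℂ`):

* `modelVectorPart`, `isZero_singularCohomology_modelVectorPart`, `toAbsolute_modelVectorPart_injective`
  — the model pair `(ℙ(F ⊕ ℂ), ℙ(F ⊕ ℂ) ∖ [0 : 1])`: its open part is acyclic (it is the affine-like
  chart of `(w, z) ↦ (w, 0)`, deformation-retracting to the point `[f₀ : 0]` for a LINE `F`), so
  relative lifts of degree `≥ 1` classes are unique;
* `omegaRel` — **the relative generator** `ω^rel(m) ∈ H²(ℙ(F ⊕ ℂ), ℙ ∖ [0 : 1]; M)`, THE lift of the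
  canonical generator `ω(m)` (`omegaModel`); `omegaRelVec` — its pull-back
  `ω^rel_vec(m) ∈ H²(F, F ∖ 0; M)` along `u ↦ [u : 1]` (Milnor–Stasheff's `u|(F, F₀)`);
* `prodVectorPartHomotopy`, `toAbsolute_prodVectorPart_injective` — on products `W × ℙ` relative lifts
  on `(W × ℙ, W × (ℙ ∖ [0 : 1]))` are unique (the scaling `[v : z] ↦ [v : (1 - t) z]` retracts the
  vertical vector part onto the slice at infinity); `toAbsolute_injective_of_homeomorph`,
  `toAbsolute_vectorPartOn_injective` — transported to `(P(λ ⊕ ℂ)|_S, vector part)` along the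
  standard local product structure `h_e` of an atlas trivialisation `e ⊇ S`;
* `omegaProd_eq_map_snd` (`ω_U = pr₂^* ω`), `IsThomClass.isNormalised_map_subsetIncl`,
  `map_subsetIncl_thomClass_eq_localThomClass` (`t|_{P|_S} = h_e^* ω_S`, Milnor–Stasheff Thm. 10.4
  over a trivialising set) and hence **`relThomClassOn_eq_model`**: the relative Thom class over
  `S ⊆ U_e` IS `(pr₂ ∘ h_e)^* ω^rel`;
* **`localIndex_eq_trivialization`**, **`localIndex_eq_vecSection`** — for an atlas trivialisation
  `e ∋ p` and `V = U_e ∩ U_p`: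

    `ind_p(s) = ⟨(b ↦ [e_b(s b) : 1])^* ω^rel, μ_p⟩ = ⟨ω^rel_vec, (b ↦ e_b(s b))_* μ_p⟩`,

  the relative Kronecker pairing in `(ℂ, ℂ ∖ 0)` of the preferred generator with the push-forward of
  the local orientation along the section read in the trivialisation (`vecSection`) — McDuff–Salamon's
  "local degree of `s` at `p`" in homological form.

Everything is proved; no named facts.

## References

* [McDuffSalamon2017] D. McDuff, D. Salamon, Introduction to Symplectic Topology, 3rd ed., OUP 2017,
  §2.7 Thm. 2.7.5 (and its proof).
* [MilnorStasheff1974] J. Milnor, J. Stasheff, Characteristic Classes, PUP 1974, §9 Thm. 9.1, §10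
  Thm. 10.2, Thm. 10.4, §12.
* [HatcherAT2002] A. Hatcher, Algebraic Topology, CUP 2002, Ch. 0 Example 0.6, §3.1 pp. 199–202.
-/

noncomputable section

open CategoryTheory Limits Function Set Bundle Topology unitInterval Literature.AlgebraicTopology.SingularHomology
open scoped LinearAlgebra.Projectivization

universe u w

namespace Literature.AlgebraicTopology.CharacteristicClasses

/-! ### Two abstract consequences of a retraction of `A` factoring through `X` -/

section Abstract

variable {R : Type w} [CommRing R] {M : Type w} [AddCommGroup M] [Module R M]
variable {X : Type u} [TopologicalSpace X] {A : Set X}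

/-- If the identity of `A` is homotopic (inside `A`) to `k ∘ (A ↪ X)` for some `k : X → A`, then
restriction `Hⁿ(X) → Hⁿ(A)` is onto (`y = (k ∘ ι)^* y = ι^* (k^* y)`). [cite: HatcherAT2002, §3.1 p. 201] -/
theorem map_subsetIncl_surjective_of_homotopic (k : C(X, ↥A))
    (hk : (ContinuousMap.id ↥A).Homotopic (k.comp (subsetIncl A))) (n : ℕ) :
    Surjective (singularCohomology.map R M (subsetIncl A) n) := by
  intro y
  refine ⟨singularCohomology.map R M k n y, ?_⟩
  rw [← ModuleCat.comp_apply, ← singularCohomology.map_comp, ← singularCohomology.map_eq_of_homotopic_holds R M hk n,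
    singularCohomology.map_id]
  rfl

/-- If restriction `Hⁿ(X) → Hⁿ(A)` is onto then `Hⁿ⁺¹(X, A) → Hⁿ⁺¹(X)` is one-to-one (the connecting
map `Hⁿ(A) → Hⁿ⁺¹(X, A)` vanishes; exactness of the sequence of the pair).
[cite: HatcherAT2002, §3.1 p. 200] -/
theorem toAbsolute_injective_of_map_subsetIncl_surjective (n : ℕ)
    (h : Surjective (singularCohomology.map R M (subsetIncl A) n)) :
    Injective (relSingularCohomology.toAbsolute R M X A (n + 1)) := by
  refine (injective_iff_map_eq_zero _).2 fun x hx ↦ ?_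
  have hex := relSingularCohomology.exact_δ_toAbsolute (R := R) (M := M) (X := X) A n (n + 1) rfl
  rw [ShortComplex.moduleCat_exact_iff] at hex
  obtain ⟨y, rfl⟩ := hex x hx
  obtain ⟨y', rfl⟩ := h y
  have h0 : singularCohomology.map R M (subsetIncl A) n ≫ relSingularCohomology.δ R M X A n (n + 1) rfl = 0 :=
    (relShortComplex_shortExact R M A).comp_δ n (n + 1) rfl
  change (singularCohomology.map R M (subsetIncl A) n ≫ relSingularCohomology.δ R M X A n (n + 1) rfl) y' = 0
  rw [h0]
  rfl

/-- Under the hypothesis of `map_subsetIncl_surjective_of_homotopic`, relative lifts are unique: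
`Hⁿ⁺¹(X, A) → Hⁿ⁺¹(X)` is one-to-one. [cite: HatcherAT2002, §3.1 pp. 200–201] -/
theorem toAbsolute_injective_of_homotopic (k : C(X, ↥A))
    (hk : (ContinuousMap.id ↥A).Homotopic (k.comp (subsetIncl A))) (n : ℕ) :
    Injective (relSingularCohomology.toAbsolute R M X A (n + 1)) :=
  toAbsolute_injective_of_map_subsetIncl_surjective n (map_subsetIncl_surjective_of_homotopic k hk n)

end Abstract

/-! ### The model vector part `ℙ(F ⊕ ℂ) ∖ [0 : 1]` is acyclic -/

section ModelPart

variable (F : Type u) [NormedAddCommGroup F] [NormedSpace ℂ F]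

/-- **The model vector part `ℙ(F ⊕ ℂ) ∖ [0 : 1] = {[w : z] | w ≠ 0}`** — the complement of the origin, so that
`H(ℙ, model vector part)` is literally the local (co)homology of `ℙ(F ⊕ ℂ)` at `[0 : 1]`. [cite: MilnorStasheff1974, §9] -/
abbrev modelVectorPart : Set (ℙ ℂ (F × ℂ)) := {zeroPt F}ᶜ

/-- Membership in the model vector part. [folklore] -/
@[simp] theorem mem_modelVectorPart_iff (ℓ : ℙ ℂ (F × ℂ)) : ℓ ∈ modelVectorPart F ↔ ℓ ≠ zeroPt F := Iff.rfl

/-- The model vector part is the chart of the projection `(w, z) ↦ (w, 0)`. [folklore] -/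
theorem modelVectorPart_eq_projChart : modelVectorPart F = projChart (fstProj F) :=
  Set.ext fun ℓ ↦ (mem_projChart_fstProj_iff F ℓ).symm

/-- `[w : z] ∈` the model vector part iff `w ≠ 0`. [folklore] -/
theorem mk_mem_modelVectorPart_iff (v : F) (z : ℂ) (h : ((v, z) : F × ℂ) ≠ 0) :
    Projectivization.mk ℂ (v, z) h ∈ modelVectorPart F ↔ v ≠ 0 :=
  (mk_eq_zeroPt_iff v z h).not

/-- A point at infinity lies in the model vector part. [folklore] -/
theorem infPt_mem_modelVectorPart (u : F) (hu : u ≠ 0) : infPt u hu ∈ modelVectorPart F :=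
  (mk_mem_modelVectorPart_iff F u 0 _).2 hu

variable (hF : Module.finrank ℂ F = 1)

include hF in
/-- On a LINE `F` the locus `{[w : 0]}` of lines in `F ⊕ 0` is a single point. [folklore] -/
theorem subsingleton_rangeLocus_fstProj : Subsingleton ↥(rangeLocus (fstProj F)) := by
  refine ⟨fun p q ↦ Subtype.ext ?_⟩
  obtain ⟨ℓ, hℓ⟩ := p
  obtain ⟨ℓ', hℓ'⟩ := q
  change ℓ = ℓ'
  induction ℓ using Projectivization.ind with
  | h w hw =>
  induction ℓ' using Projectivization.ind with
  | h w' hw' =>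
    obtain ⟨v, z⟩ := w
    obtain ⟨v', z'⟩ := w'
    have hz : z = 0 := by
      have h := (mk_mem_rangeLocus_iff (fstProj F) (v, z) hw).1 hℓ
      rw [fstProj_apply] at h
      exact ((Prod.ext_iff.1 h).2).symm
    have hz' : z' = 0 := by
      have h := (mk_mem_rangeLocus_iff (fstProj F) (v', z') hw').1 hℓ'
      rw [fstProj_apply] at h
      exact ((Prod.ext_iff.1 h).2).symm
    subst hz hz'
    have hv : v ≠ 0 := fun hv ↦ hw (by rw [hv]; rfl)
    have hv' : v' ≠ 0 := fun hv' ↦ hw' (by rw [hv']; rfl)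
    exact infPt_eq_infPt hF hv hv'

include hF in
/-- **The model vector part is acyclic: `Hᵏ(ℙ(F ⊕ ℂ) ∖ [0 : 1]; M) = 0` for `k ≠ 0`** (it deformation
retracts onto the point at infinity, `rangeLocusHomotopyEquiv` for the projection `(w, z) ↦ (w, 0)`).
[cite: HatcherAT2002, Ch. 0 Example 0.6] -/
theorem isZero_singularCohomology_modelVectorPart (R : Type w) [CommRing R] (M : Type w) [AddCommGroup M]
    [Module R M] {k : ℕ} (hk : k ≠ 0) : IsZero (singularCohomology R M ↥(modelVectorPart F) k) := by
  haveI := subsingleton_rangeLocus_fstProj F hF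
  have h0 : IsZero (singularCohomology R M ↥(rangeLocus (fstProj F)) k) :=
    isZero_singularCohomology_of_subsingleton_holds R M hk
  have h1 : IsZero (singularCohomology R M ↥(projChart (fstProj F)) k) :=
    h0.of_iso (singularCohomology.isoOfHomotopyEquiv' R M (rangeLocusHomotopyEquiv (fstProj F) (fstProj_idem F)) k)
  rw [modelVectorPart_eq_projChart]
  exact h1

/-! ### The relative generator `ω^rel ∈ H²(ℙ(F ⊕ ℂ), ℙ(F ⊕ ℂ) ∖ [0 : 1])` -/

variable (R : Type w) [CommRing R] (M : Type w) [AddCommGroup M] [Module R M]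

include hF in
/-- `H²(ℙ, ℙ ∖ [0 : 1]) → H²(ℙ)` is one-to-one (the vector part has `H¹ = 0`). [folklore] -/
theorem toAbsolute_modelVectorPart_injective :
    Injective (relSingularCohomology.toAbsolute R M (ℙ ℂ (F × ℂ)) (modelVectorPart F) 2) := by
  refine toAbsolute_injective_of_map_subsetIncl_surjective 1 fun y ↦ ⟨0, ?_⟩
  haveI := ModuleCat.subsingleton_of_isZero (isZero_singularCohomology_modelVectorPart F hF R M one_ne_zero)
  exact Subsingleton.elim _ _

/-- A lift of `ω(m)` to `H²(ℙ, ℙ ∖ [0 : 1])` exists (the vector part has `H² = 0`). [folklore] -/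
theorem exists_omegaRel (m : M) :
    ∃ x : relSingularCohomology R M (ℙ ℂ (F × ℂ)) (modelVectorPart F) 2,
      relSingularCohomology.toAbsolute R M (ℙ ℂ (F × ℂ)) (modelVectorPart F) 2 x = omegaModel F hF R M m := by
  have hex := relSingularCohomology.exact_toAbsolute_map (R := R) (M := M) (modelVectorPart F) 2
  rw [ShortComplex.moduleCat_exact_iff] at hex
  haveI := ModuleCat.subsingleton_of_isZero (isZero_singularCohomology_modelVectorPart F hF R M two_ne_zero)
  exact hex (omegaModel F hF R M m) (Subsingleton.elim _ _)

/-- **The relative generator `ω^rel(m) ∈ H²(ℙ(F ⊕ ℂ), ℙ(F ⊕ ℂ) ∖ [0 : 1]; M)`**: THE lift of the canonical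
generator `ω(m)` (`omegaModel`) — the local relative Thom class of the model (Milnor–Stasheff's
`u|_{(F, F₀)}`, the preferred generator of `H²(ℝ², ℝ² ∖ 0)`, in the projective model).
[cite: MilnorStasheff1974, §9 Thm. 9.1] -/
def omegaRel (m : M) : relSingularCohomology R M (ℙ ℂ (F × ℂ)) (modelVectorPart F) 2 :=
  (exists_omegaRel F hF R M m).choose

/-- `ω^rel(m)` lifts `ω(m)`. [cite: MilnorStasheff1974, §9 Thm. 9.1] -/
theorem toAbsolute_omegaRel (m : M) :
    relSingularCohomology.toAbsolute R M (ℙ ℂ (F × ℂ)) (modelVectorPart F) 2 (omegaRel F hF R M m) =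
      omegaModel F hF R M m :=
  (exists_omegaRel F hF R M m).choose_spec

variable {R M} in
/-- Uniqueness of `ω^rel(m)`. [folklore] -/
theorem eq_omegaRel_of_toAbsolute_eq {m : M} {x : relSingularCohomology R M (ℙ ℂ (F × ℂ)) (modelVectorPart F) 2}
    (hx : relSingularCohomology.toAbsolute R M (ℙ ℂ (F × ℂ)) (modelVectorPart F) 2 x = omegaModel F hF R M m) :
    x = omegaRel F hF R M m :=
  toAbsolute_modelVectorPart_injective F hF R M (hx.trans (toAbsolute_omegaRel F hF R M m).symm)

end ModelPart

/-! ### Products `(W × ℙ(F ⊕ ℂ), W × (ℙ(F ⊕ ℂ) ∖ [0 : 1]))`: relative lifts are unique -/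

section Product

variable (F : Type u) [NormedAddCommGroup F] [NormedSpace ℂ F] (hF : Module.finrank ℂ F = 1)
  (W : Type u) [TopologicalSpace W]

/-- The vertical vector part `W × (ℙ(F ⊕ ℂ) ∖ [0 : 1])` of the product. [folklore] -/
abbrev prodVectorPart : Set (W × ℙ ℂ (F × ℂ)) := (Prod.snd : W × ℙ ℂ (F × ℂ) → ℙ ℂ (F × ℂ)) ⁻¹' modelVectorPart F

/-- The retraction `(w, ℓ) ↦ (w, [f₀ : 0])` of the product onto the slice at infinity, with values in
the vertical vector part. [folklore] -/
def prodInfRetract : C(W × ℙ ℂ (F × ℂ), ↥(prodVectorPart F W)) where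
  toFun q := ⟨(q.1, infPt (modelVec F hF) (modelVec_ne_zero F hF)),
    infPt_mem_modelVectorPart F (modelVec F hF) (modelVec_ne_zero F hF)⟩
  continuous_toFun := (continuous_fst.prodMk continuous_const).subtype_mk _

/-- **`𝟙 ≃ (w, ℓ) ↦ (w, [f₀ : 0])` INSIDE the vertical vector part**, by the scaling
`(w, [v : z]) ↦ (w, [v : (1 - t) z])`. [cite: HatcherAT2002, Ch. 0 Example 0.6] -/
def prodVectorPartHomotopy :
    ContinuousMap.Homotopy (ContinuousMap.id ↥(prodVectorPart F W))
      ((prodInfRetract F hF W).comp (subsetIncl (prodVectorPart F W))) where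
  toFun q := ⟨(q.2.1.1, lineScale ((1 - (q.1 : ℝ) : ℝ) : ℂ) q.2.1.2), by
    obtain ⟨t, ⟨⟨w, ℓ⟩, hℓ⟩⟩ := q
    change lineScale _ ℓ ∈ modelVectorPart F
    change ℓ ∈ modelVectorPart F at hℓ
    induction ℓ using Projectivization.ind with
    | h x hx =>
      obtain ⟨v, z⟩ := x
      have hv : v ≠ 0 := (mk_mem_modelVectorPart_iff F v z hx).1 hℓ
      rw [lineScale_mk _ hv z hx]
      exact (mk_mem_modelVectorPart_iff F v _ _).2 hv⟩
  continuous_toFun := by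
    refine Continuous.subtype_mk ?_ _
    refine ((continuous_fst.comp continuous_subtype_val).comp continuous_snd).prodMk ?_
    have h1 : Continuous fun q : I × ↥(prodVectorPart F W) ↦ ((q.1, q.2.1.2) : I × ℙ ℂ (F × ℂ)) :=
      continuous_fst.prodMk ((continuous_snd.comp continuous_subtype_val).comp continuous_snd)
    exact (continuousOn_lineScale F).comp_continuous h1 fun q ↦ q.2.2
  map_zero_left q := by
    apply Subtype.ext
    change ((q.1.1, lineScale ((1 - ((0 : I) : ℝ) : ℝ) : ℂ) q.1.2) : W × ℙ ℂ (F × ℂ)) = q.1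
    rw [show ((1 - ((0 : I) : ℝ) : ℝ) : ℂ) = 1 by norm_num, lineScale_one]
  map_one_left q := by
    obtain ⟨⟨w, ℓ⟩, hℓ⟩ := q
    apply Subtype.ext
    refine Prod.ext rfl ?_
    change lineScale ((1 - ((1 : I) : ℝ) : ℝ) : ℂ) ℓ = infPt (modelVec F hF) (modelVec_ne_zero F hF)
    change ℓ ∈ modelVectorPart F at hℓ
    induction ℓ using Projectivization.ind with
    | h x hx =>
      obtain ⟨v, z⟩ := x
      have hv : v ≠ 0 := (mk_mem_modelVectorPart_iff F v z hx).1 hℓ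
      rw [show ((1 - ((1 : I) : ℝ) : ℝ) : ℂ) = 0 by norm_num, lineScale_zero_mk hv z hx]
      exact infPt_eq_infPt hF hv _

include hF in
/-- **Relative lifts on `(W × ℙ, W × (ℙ ∖ [0 : 1]))` are unique**: `Hⁿ⁺¹(W × ℙ, W × ℙ₀) → Hⁿ⁺¹(W × ℙ)` is
one-to-one. [cite: HatcherAT2002, §3.1 pp. 200–201] -/
theorem toAbsolute_prodVectorPart_injective (R : Type w) [CommRing R] (M : Type w) [AddCommGroup M] [Module R M]
    (n : ℕ) : Injective (relSingularCohomology.toAbsolute R M (W × ℙ ℂ (F × ℂ)) (prodVectorPart F W) (n + 1)) :=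
  toAbsolute_injective_of_homotopic (prodInfRetract F hF W) ⟨prodVectorPartHomotopy F hF W⟩ n

end Product

/-! ### Transport of relative classes along homeomorphisms of pairs -/

section Transport

variable {R : Type w} [CommRing R] {M : Type w} [AddCommGroup M] [Module R M]
variable {X Y : Type u} [TopologicalSpace X] [TopologicalSpace Y]

/-- `Ψ^* ∘ (Ψ⁻¹)^* = 𝟙` on relative cohomology, for a homeomorphism of pairs `Ψ`. [folklore] -/
theorem relMap_homeomorph_relMap_symm (Ψ : X ≃ₜ Y) {A : Set X} {B : Set Y} (hΨ : MapsTo (Ψ : C(X, Y)) A B)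
    (hΨ' : MapsTo (Ψ.symm : C(Y, X)) B A) (n : ℕ) (z : relSingularCohomology R M X A n) :
    relSingularCohomology.map R M (Ψ : C(X, Y)) hΨ n (relSingularCohomology.map R M (Ψ.symm : C(Y, X)) hΨ' n z) = z := by
  change (relSingularCohomology.map R M (Ψ.symm : C(Y, X)) hΨ' n ≫ relSingularCohomology.map R M (Ψ : C(X, Y)) hΨ n) z = z
  rw [← relSingularCohomology.map_comp,
    relSingularCohomology.map_congr (Homeomorph.symm_comp_toContinuousMap Ψ) (hΨ'.comp hΨ) (mapsTo_id A) n,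
    relSingularCohomology.map_id]
  rfl

/-- **Uniqueness of relative lifts transports along homeomorphisms of pairs**: if
`Hⁿ(Y, B) → Hⁿ(Y)` is one-to-one and `Ψ : (X, A) ≅ (Y, B)`, then `Hⁿ(X, A) → Hⁿ(X)` is one-to-one. [folklore] -/
theorem toAbsolute_injective_of_homeomorph (Ψ : X ≃ₜ Y) {A : Set X} {B : Set Y} (hΨ : MapsTo (Ψ : C(X, Y)) A B)
    (hΨ' : MapsTo (Ψ.symm : C(Y, X)) B A) (n : ℕ)
    (hY : Injective (relSingularCohomology.toAbsolute R M Y B n)) :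
    Injective (relSingularCohomology.toAbsolute R M X A n) := by
  intro x x' h
  have h' : relSingularCohomology.map R M (Ψ.symm : C(Y, X)) hΨ' n x =
      relSingularCohomology.map R M (Ψ.symm : C(Y, X)) hΨ' n x' := by
    apply hY
    change (relSingularCohomology.map R M (Ψ.symm : C(Y, X)) hΨ' n ≫ relSingularCohomology.toAbsolute R M Y B n) x =
      (relSingularCohomology.map R M (Ψ.symm : C(Y, X)) hΨ' n ≫ relSingularCohomology.toAbsolute R M Y B n) x'
    rw [relSingularCohomology.map_comp_toAbsolute, ModuleCat.comp_apply, ModuleCat.comp_apply, h]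
  rw [← relMap_homeomorph_relMap_symm Ψ hΨ hΨ' n x, h', relMap_homeomorph_relMap_symm]

end Transport

/-! ### `ω_U = pr₂^* ω` on products -/

section OmegaProd

variable (F : Type u) [NormedAddCommGroup F] [NormedSpace ℂ F] (hF : Module.finrank ℂ F = 1)
  (R : Type w) [CommRing R] (M : Type w) [AddCommGroup M] [Module R M]

/-- **`ω_U(m) = pr₂^* ω(m)`**: the product class on `U × ℙ(F ⊕ ℂ)` is the pull-back of the fibre
generator along the second projection (naturality of `ω_U` in `U` at `U → pt`). [cite: HatcherAT2002, §3.1 pp. 200–202] -/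
theorem omegaProd_eq_map_snd (U : Type u) [TopologicalSpace U] (m : M) :
    (modelSphereLike F hF).omegaProd R M U m =
      singularCohomology.map R M (ContinuousMap.snd : C(U × ℙ ℂ (F × ℂ), ℙ ℂ (F × ℂ))) 2 (omegaModel F hF R M m) := by
  rw [omegaModel, IsSphereLike.omegaFibre, ← ModuleCat.comp_apply, ← singularCohomology.map_comp,
    ← (modelSphereLike F hF).map_prodMapId_omegaProd R M (ContinuousMap.const U PUnit.unit) m]
  rfl

end OmegaProd

/-! ### The vector model `(F, F ∖ 0)` and its relative generator -/

section VectorModel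

variable (F : Type u) [NormedAddCommGroup F] [NormedSpace ℂ F] (hF : Module.finrank ℂ F = 1)
  (R : Type w) [CommRing R] (M : Type w) [AddCommGroup M] [Module R M]

/-- **The fibre embedding `α : F → ℙ(F ⊕ ℂ)`, `u ↦ [u : 1]`.** [cite: MilnorStasheff1974, §12] -/
def vecEmbed : C(F, ℙ ℂ (F × ℂ)) :=
  ⟨fun u ↦ Projectivization.mk ℂ (u, (1 : ℂ)) (pair_one_ne_zero u),
    (continuous_id.prodMk continuous_const).projectivizationMk _⟩

/-- `α u = [u : 1]`. [folklore] -/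
theorem vecEmbed_apply (u : F) : vecEmbed F u = Projectivization.mk ℂ (u, (1 : ℂ)) (pair_one_ne_zero u) := rfl

/-- `α` is a map of pairs `(F, F ∖ 0) → (ℙ(F ⊕ ℂ), ℙ(F ⊕ ℂ) ∖ [0 : 1])`. [folklore] -/
theorem mapsTo_vecEmbed : MapsTo (vecEmbed F) ({0}ᶜ : Set F) (modelVectorPart F) :=
  fun u hu ↦ (mk_mem_modelVectorPart_iff F u 1 _).2 hu

/-- **The relative generator `ω^rel_vec(m) := α^* ω^rel(m) ∈ H²(F, F ∖ 0; M)` of the vector model**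
— Milnor–Stasheff's preferred generator `u|_{(F, F₀)}` of the fibre pair of an oriented (here:
complex line) bundle. [cite: MilnorStasheff1974, §9 Thm. 9.1] -/
def omegaRelVec (m : M) : relSingularCohomology R M F ({0}ᶜ : Set F) 2 :=
  relSingularCohomology.map R M (vecEmbed F) (mapsTo_vecEmbed F) 2 (omegaRel F hF R M m)

end VectorModel

/-! ### The restriction of the Thom class to `P(λ ⊕ ℂ)|_S` -/

section Bundle

variable {B : Type u} [TopologicalSpace B] (F : Type u) [NormedAddCommGroup F] [NormedSpace ℂ F] [FiniteDimensional ℂ F]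
  (E : B → Type u) [∀ b, AddCommGroup (E b)] [∀ b, Module ℂ (E b)]
  [TopologicalSpace (TotalSpace F E)] [∀ b, TopologicalSpace (E b)] [FiberBundle F E] [VectorBundle ℂ F E]
  (hF : Module.finrank ℂ F = 1) (R : Type u) [CommRing R]

/-- A Thom class restricts to a normalised class over every `S ⊆ B`. [cite: MilnorStasheff1974, §10 Thm. 10.4] -/
theorem IsThomClass.isNormalised_map_subsetIncl {m : R} {t : singularCohomology R R (ProjCompl F E) 2}
    (ht : IsThomClass F E hF R m t) (S : Set B) :
    IsNormalised F E hF R R S m (singularCohomology.map R R (subsetIncl (complPreimage F E S)) 2 t) where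
  map_complInfOn := by
    rw [← ModuleCat.comp_apply, ← singularCohomology.map_comp, subsetIncl_comp_complInfOn F E hF,
      singularCohomology.map_comp, ModuleCat.comp_apply, ht.map_complInf, map_zero]
  map_complFibOn b hb := by
    rw [← ModuleCat.comp_apply, ← singularCohomology.map_comp, subsetIncl_comp_complFibOn F E hb, ht.map_complFibreIncl]

/-- **Over a set inside an atlas trivialisation the Thom class IS the local Thom class**:
`t|_{P(λ ⊕ ℂ)|_S} = h_e^* ω_S` for `S ⊆ U_e`. [cite: MilnorStasheff1974, §10 Thm. 10.4] -/
theorem map_subsetIncl_thomClass_eq_localThomClass [T2Space B] [ParacompactSpace B]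
    (e : Trivialization F (π F E)) [MemTrivializationAtlas e] {S : Set B} (hS : S ⊆ e.baseSet) (m : R) :
    singularCohomology.map R R (subsetIncl (complPreimage F E S)) 2 (thomClass F E hF R m) = localThomClass hF R R e hS m :=
  ((isThomClass_thomClass F E hF R m).isNormalised_map_subsetIncl F E hF R S).eq_localThomClass hF e hS

/-! ### The pair `(P(λ ⊕ ℂ)|_S, its vector part)` and the standard local product structure -/

variable {F E}

/-- The vector part of `P(λ ⊕ ℂ)|_S`. [folklore] -/
abbrev vectorPartOn (S : Set B) : Set ↥(complPreimage F E S) := Subtype.val ⁻¹' vectorPart F E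

/-- **The standard local product structure matches the vector parts**: the fibre coordinate of `h_e q`
is off the origin iff `q` is in the vector part. [folklore] -/
theorem stdLocalHomeomorph_snd_mem_iff (e : Trivialization F (π F E)) [MemTrivializationAtlas e] {S : Set B}
    (hS : S ⊆ e.baseSet) (q : ↥(complPreimage F E S)) :
    (stdLocalHomeomorph hF e hS q).2 ∈ modelVectorPart (ULift.{u} ℂ) ↔ q.1 ∈ vectorPart F E := by
  obtain ⟨⟨b, ℓ⟩, hb⟩ := q
  induction ℓ using Projectivization.ind with
  | h w hw =>
    obtain ⟨v, z⟩ := w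
    rw [stdLocalHomeomorph_apply_mk hF e hS hb]
    change Projectivization.mk ℂ (((linEquivAt ℂ F E e b).trans (stdEquiv F hF)) v, z)
        ((((linEquivAt ℂ F E e b).trans (stdEquiv F hF)).prodCongr (ContinuousLinearEquiv.refl ℂ ℂ)).map_ne_zero_iff.2 hw)
          ∈ modelVectorPart (ULift.{u} ℂ) ↔
      (⟨b, Projectivization.mk ℂ (v, z) hw⟩ : ProjCompl F E) ∈ vectorPart F E
    rw [mk_mem_modelVectorPart_iff, mk_mem_vectorPart_iff]
    exact ((linEquivAt ℂ F E e b).trans (stdEquiv F hF)).map_ne_zero_iff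

/-- `h_e` is a map of pairs (vector parts). [folklore] -/
theorem mapsTo_stdLocalHomeomorph (e : Trivialization F (π F E)) [MemTrivializationAtlas e] {S : Set B}
    (hS : S ⊆ e.baseSet) :
    MapsTo (stdLocalHomeomorph hF e hS : C(↥(complPreimage F E S), ↥S × ℙ ℂ (ULift.{u} ℂ × ℂ)))
      (vectorPartOn S) (prodVectorPart (ULift.{u} ℂ) ↥S) :=
  fun q hq ↦ (stdLocalHomeomorph_snd_mem_iff hF e hS q).2 hq

/-- `h_e⁻¹` is a map of pairs (vector parts). [folklore] -/
theorem mapsTo_stdLocalHomeomorph_symm (e : Trivialization F (π F E)) [MemTrivializationAtlas e] {S : Set B}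
    (hS : S ⊆ e.baseSet) :
    MapsTo ((stdLocalHomeomorph hF e hS).symm : C(↥S × ℙ ℂ (ULift.{u} ℂ × ℂ), ↥(complPreimage F E S)))
      (prodVectorPart (ULift.{u} ℂ) ↥S) (vectorPartOn S) := by
  intro q hq
  have h := (stdLocalHomeomorph_snd_mem_iff hF e hS ((stdLocalHomeomorph hF e hS).symm q)).1
  rw [Homeomorph.apply_symm_apply] at h
  exact h hq

/-- `pr₂ ∘ h_e` is a map of pairs `(P|_S, vector part) → (ℙ(ℂ ⊕ ℂ), ℙ(ℂ ⊕ ℂ) ∖ [0 : 1])`. [folklore] -/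
theorem mapsTo_snd_comp_stdLocalHomeomorph (e : Trivialization F (π F E)) [MemTrivializationAtlas e] {S : Set B}
    (hS : S ⊆ e.baseSet) :
    MapsTo ((ContinuousMap.snd : C(↥S × ℙ ℂ (ULift.{u} ℂ × ℂ), ℙ ℂ (ULift.{u} ℂ × ℂ))).comp
      (stdLocalHomeomorph hF e hS : C(↥(complPreimage F E S), ↥S × ℙ ℂ (ULift.{u} ℂ × ℂ))))
      (vectorPartOn S) (modelVectorPart (ULift.{u} ℂ)) :=
  fun q hq ↦ (stdLocalHomeomorph_snd_mem_iff hF e hS q).2 hq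

/-- The inclusion `P(λ ⊕ ℂ)|_S ↪ P(λ ⊕ ℂ)` is a map of pairs (vector parts). [folklore] -/
theorem mapsTo_subsetIncl_complPreimage (S : Set B) :
    MapsTo (subsetIncl (complPreimage F E S)) (vectorPartOn S) (vectorPart F E) := fun _ hq ↦ hq

include hF in
/-- **Relative lifts on `(P|_S, vector part)` are unique over a trivialisable `S`**: transport of the
product statement along `h_e`. [cite: HatcherAT2002, §3.1 pp. 200–201] -/
theorem toAbsolute_vectorPartOn_injective (e : Trivialization F (π F E)) [MemTrivializationAtlas e] {S : Set B}
    (hS : S ⊆ e.baseSet) (n : ℕ) :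
    Injective (relSingularCohomology.toAbsolute R R ↥(complPreimage F E S) (vectorPartOn S) (n + 1)) :=
  toAbsolute_injective_of_homeomorph (stdLocalHomeomorph hF e hS) (mapsTo_stdLocalHomeomorph hF e hS)
    (mapsTo_stdLocalHomeomorph_symm hF e hS) (n + 1)
    (toAbsolute_prodVectorPart_injective (ULift.{u} ℂ) finrank_model ↥S R R n)

/-- **The relative Thom class over `S`**: `t̃|_{(P|_S, vector part)}`. [cite: MilnorStasheff1974, §10 Thm. 10.4] -/
def relThomClassOn [T2Space B] [ParacompactSpace B] (S : Set B) (m : R) :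
    relSingularCohomology R R ↥(complPreimage F E S) (vectorPartOn S) 2 :=
  relSingularCohomology.map R R (subsetIncl (complPreimage F E S)) (mapsTo_subsetIncl_complPreimage S) 2
    (relThomClass F E hF R m)

/-- `t̃|_S` lifts `t|_{P|_S}`. [folklore] -/
theorem toAbsolute_relThomClassOn [T2Space B] [ParacompactSpace B] (S : Set B) (m : R) :
    relSingularCohomology.toAbsolute R R ↥(complPreimage F E S) (vectorPartOn S) 2 (relThomClassOn hF R S m) =
      singularCohomology.map R R (subsetIncl (complPreimage F E S)) 2 (thomClass F E hF R m) := by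
  rw [relThomClassOn, ← ModuleCat.comp_apply, relSingularCohomology.map_comp_toAbsolute, ModuleCat.comp_apply,
    toAbsolute_relThomClass]

/-- **The model relative Thom class over `S ⊆ U_e`**: `(pr₂ ∘ h_e)^* ω^rel_std`, the MODEL relative
generator pulled back along the standard local product structure `h_e : P(λ ⊕ ℂ)|_S ≅ S × ℙ(ℂ ⊕ ℂ)`
(a map of pairs). [cite: MilnorStasheff1974, §10 Thm. 10.2] -/
def modelRelThomClassOn (e : Trivialization F (π F E)) [MemTrivializationAtlas e] {S : Set B} (hS : S ⊆ e.baseSet)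
    (m : R) : relSingularCohomology R R ↥(complPreimage F E S) (vectorPartOn S) 2 :=
  relSingularCohomology.map R R
    ((ContinuousMap.snd : C(↥S × ℙ ℂ (ULift.{u} ℂ × ℂ), ℙ ℂ (ULift.{u} ℂ × ℂ))).comp
      (stdLocalHomeomorph hF e hS : C(↥(complPreimage F E S), ↥S × ℙ ℂ (ULift.{u} ℂ × ℂ))))
    (mapsTo_snd_comp_stdLocalHomeomorph hF e hS) 2 (omegaRel (ULift.{u} ℂ) finrank_model R R m)

/-- The model relative Thom class lifts the local Thom class `h_e^* ω_S = (pr₂ ∘ h_e)^* ω`. [folklore] -/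
theorem toAbsolute_modelRelThomClassOn (e : Trivialization F (π F E)) [MemTrivializationAtlas e] {S : Set B}
    (hS : S ⊆ e.baseSet) (m : R) :
    relSingularCohomology.toAbsolute R R ↥(complPreimage F E S) (vectorPartOn S) 2 (modelRelThomClassOn hF R e hS m) =
      localThomClass hF R R e hS m := by
  rw [modelRelThomClassOn, ← ModuleCat.comp_apply, relSingularCohomology.map_comp_toAbsolute, ModuleCat.comp_apply,
    toAbsolute_omegaRel, localThomClass, omegaProd_eq_map_snd (ULift.{u} ℂ) finrank_model R R ↥S m,
    singularCohomology.map_comp, ModuleCat.comp_apply]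

/-- **The relative Thom class over a trivialising set IS the model class**: `t̃|_S = (pr₂ ∘ h_e)^* ω^rel_std`
for `S ⊆ U_e` — both lift `t|_{P|_S} = h_e^* ω_S` and relative lifts on `(P|_S, vector part)` are
unique. [cite: MilnorStasheff1974, §10 Thm. 10.4] -/
theorem relThomClassOn_eq_model [T2Space B] [ParacompactSpace B] (e : Trivialization F (π F E))
    [MemTrivializationAtlas e] {S : Set B} (hS : S ⊆ e.baseSet) (m : R) :
    relThomClassOn hF R S m = modelRelThomClassOn hF R e hS m :=
  toAbsolute_vectorPartOn_injective hF R e hS 1 (((toAbsolute_relThomClassOn hF R S m).trans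
    (map_subsetIncl_thomClass_eq_localThomClass F E hF R e hS m)).trans (toAbsolute_modelRelThomClassOn hF R e hS m).symm)

/-! ### The local index in a trivialisation -/

variable (m : R) (s : ∀ b, E b) (hs : Continuous fun b ↦ (⟨b, s b⟩ : TotalSpace F E))

/-- The projectivised section over `V ⊆ S`, with values in `P(λ ⊕ ℂ)|_S`. [folklore] -/
def projSectionOn {V S : Set B} (hVS : V ⊆ S) : C(↥V, ↥(complPreimage F E S)) where
  toFun b := ⟨projSection s hs b, hVS b.2⟩
  continuous_toFun := ((projSection s hs).continuous.comp continuous_subtype_val).subtype_mk _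

/-- `(inclusion) ∘ ŝ_V = ŝ ∘ (V ⊆ B)`. [folklore] -/
theorem subsetIncl_comp_projSectionOn {V S : Set B} (hVS : V ⊆ S) :
    (subsetIncl (complPreimage F E S)).comp (projSectionOn s hs hVS) = (projSection s hs).comp (subsetIncl V) := rfl

/-- **The model section `b ↦ [e_b(s b) : 1] ∈ ℙ(ℂ ⊕ ℂ)` over `V ⊆ U_e`**: the section read in the
atlas trivialisation `e` (fibre coordinate moved to the fixed line `ULift ℂ` by `stdEquiv`), as a
point of the model projective line. [cite: McDuffSalamon2017, Thm. 2.7.5] -/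
def modelSection (e : Trivialization F (π F E)) [MemTrivializationAtlas e] {V : Set B} (hV : V ⊆ e.baseSet) :
    C(↥V, ℙ ℂ (ULift.{u} ℂ × ℂ)) :=
  ((ContinuousMap.snd : C(↥(e.baseSet) × ℙ ℂ (ULift.{u} ℂ × ℂ), ℙ ℂ (ULift.{u} ℂ × ℂ))).comp
    (stdLocalHomeomorph hF e subset_rfl : C(↥(complPreimage F E e.baseSet), ↥(e.baseSet) × ℙ ℂ (ULift.{u} ℂ × ℂ)))).comp
      (projSectionOn s hs hV)

/-- `modelSection b = [e_b(s b) : 1]`. [folklore] -/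
theorem modelSection_apply (e : Trivialization F (π F E)) [MemTrivializationAtlas e] {V : Set B} (hV : V ⊆ e.baseSet)
    (b : ↥V) :
    modelSection hF s hs e hV b =
      Projectivization.mk ℂ (stdEquiv F hF (linEquivAt ℂ F E e b (s b)), (1 : ℂ)) (pair_one_ne_zero _) := by
  change (stdLocalHomeomorph hF e subset_rfl
    ⟨⟨(b : B), Projectivization.mk ℂ (s b, (1 : ℂ)) (pair_one_ne_zero _)⟩, hV b.2⟩).2 = _
  rw [stdLocalHomeomorph_apply_mk hF e subset_rfl (hV b.2)]
  rfl

/-- Off `p` the model section is off the origin (inside the index domain). [folklore] -/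
theorem mapsTo_modelSection (e : Trivialization F (π F E)) [MemTrivializationAtlas e] {V : Set B}
    (hV : V ⊆ e.baseSet) {p : B} (hpV : p ∈ V) (hVU : V ⊆ indexDomain s p) :
    MapsTo (modelSection hF s hs e hV) ({(⟨p, hpV⟩ : ↥V)}ᶜ : Set ↥V) (modelVectorPart (ULift.{u} ℂ)) := by
  intro b hb
  have hb' : s b.1 ≠ 0 := by
    rcases hVU b.2 with h | h
    · exact absurd (Subtype.ext h) hb
    · exact h
  rw [modelSection_apply, mem_modelVectorPart_iff, Ne, mk_eq_zeroPt_iff]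
  exact ((linEquivAt ℂ F E e b).trans (stdEquiv F hF)).map_ne_zero_iff.2 hb'

/-- **The local index in a trivialisation**: for an atlas trivialisation `e` at the isolated zero `p`
and `V = U_e ∩ U_p`,

  `ind_p(s) = ⟨(b ↦ [e_b(s b) : 1])^* ω^rel_std, μ_p⟩`

— the relative Kronecker pairing on `(V, V ∖ p)` of the pull-back of the MODEL relative generator
`ω^rel_std ∈ H²(ℙ(ℂ ⊕ ℂ), ℙ(ℂ ⊕ ℂ) ∖ [0 : 1])` along the section read in the trivialisation, with the
local orientation (McDuff–Salamon 2017, proof of Thm. 2.7.5: the multiplicity of a zero is the local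
degree of the section in a trivialisation; Milnor–Stasheff §9–§10: the Thom class is the preferred
generator on each fibre). [cite: McDuffSalamon2017, Thm. 2.7.5] -/
theorem localIndex_eq_trivialization [T2Space B] [ParacompactSpace B] (e : Trivialization F (π F E))
    [MemTrivializationAtlas e] (μ : HomologicalOrientation R B 2) (p : B) (hU : IsOpen (indexDomain s p))
    (hp : p ∈ e.baseSet) :
    localIndex hF R m s hs μ p =
      relKroneckerM R ↥(e.baseSet ∩ indexDomain s p)
        ({(⟨p, ⟨hp, mem_indexDomain_self s p⟩⟩ : ↥(e.baseSet ∩ indexDomain s p))}ᶜ : Set _) 2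
        (relSingularCohomology.map R R (modelSection hF s hs e inter_subset_left)
          (mapsTo_modelSection hF s hs e inter_subset_left ⟨hp, mem_indexDomain_self s p⟩ inter_subset_right) 2
          (omegaRel (ULift.{u} ℂ) finrank_model R R m))
        ((localHomology.openSubsetIso R R (e.open_baseSet.inter hU) ⟨hp, mem_indexDomain_self s p⟩ 2).inv
          (μ.localClass p)) := by
  have hpV : p ∈ e.baseSet ∩ indexDomain s p := ⟨hp, mem_indexDomain_self s p⟩
  -- `(ŝ|_V)^* t̃ = (ŝ_V)^* (t̃|_{U_e})`
  have hmaps : MapsTo (projSectionOn s hs (inter_subset_left : e.baseSet ∩ indexDomain s p ⊆ e.baseSet))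
      ({(⟨p, hpV⟩ : ↥(e.baseSet ∩ indexDomain s p))}ᶜ : Set _) (vectorPartOn e.baseSet) := fun b hb ↦
    mapsTo_projSection_of_subset s hs hpV inter_subset_right hb
  have hfac : relSingularCohomology.map R R ((projSection s hs).comp (subsetIncl (e.baseSet ∩ indexDomain s p)))
      (mapsTo_projSection_of_subset s hs hpV inter_subset_right) 2 (relThomClass F E hF R m) =
      relSingularCohomology.map R R (projSectionOn s hs (inter_subset_left : e.baseSet ∩ indexDomain s p ⊆ e.baseSet))
        hmaps 2 (relThomClassOn hF R e.baseSet m) := by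
    rw [relThomClassOn, ← ModuleCat.comp_apply, ← relSingularCohomology.map_comp,
      relSingularCohomology.map_congr (subsetIncl_comp_projSectionOn s hs inter_subset_left) _
        (mapsTo_projSection_of_subset s hs hpV inter_subset_right) 2]
  rw [localIndex_eq_of_subset hF R m s hs μ p hU (e.open_baseSet.inter hU) hpV inter_subset_right, hfac,
    relThomClassOn_eq_model hF R e subset_rfl m, modelRelThomClassOn, ← ModuleCat.comp_apply,
    ← relSingularCohomology.map_comp]
  rfl

/-! ### The local index through the vector model -/

/-- **The vector section `b ↦ e_b(s b) ∈ ULift ℂ` over `V ⊆ U_e`**: the section read in the atlas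
trivialisation `e`, fibre coordinate moved to the fixed line. [cite: McDuffSalamon2017, Thm. 2.7.5] -/
def vecSection (e : Trivialization F (π F E)) [MemTrivializationAtlas e] {V : Set B} (hV : V ⊆ e.baseSet) :
    C(↥V, ULift.{u} ℂ) where
  toFun b := stdEquiv F hF (e ⟨b, s b⟩).2
  continuous_toFun := by
    have h2 : Continuous fun b : ↥V ↦ (⟨(b : B), s b⟩ : TotalSpace F E) := hs.comp continuous_subtype_val
    have h3 : Continuous fun b : ↥V ↦ e ⟨(b : B), s b⟩ := by
      refine continuous_iff_continuousAt.2 fun b ↦ ?_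
      have hb : (⟨(b : B), s b⟩ : TotalSpace F E) ∈ e.source := by
        rw [e.source_eq]
        exact hV b.2
      exact ContinuousAt.comp (f := fun b : ↥V ↦ (⟨(b : B), s b⟩ : TotalSpace F E)) (e.continuousAt hb) h2.continuousAt
    exact (stdEquiv F hF).continuous.comp (continuous_snd.comp h3)

omit [FiniteDimensional ℂ F] in
/-- `vecSection b = e_b(s b)` (through `linEquivAt`). [folklore] -/
theorem vecSection_apply (e : Trivialization F (π F E)) [MemTrivializationAtlas e] {V : Set B} (hV : V ⊆ e.baseSet)
    (b : ↥V) : vecSection hF s hs e hV b = stdEquiv F hF (linEquivAt ℂ F E e b (s b)) := by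
  rw [linEquivAt_apply (K := ℂ) e (hV b.2)]
  rfl

/-- `[· : 1] ∘ (vector section) = model section`. [folklore] -/
theorem vecEmbed_comp_vecSection (e : Trivialization F (π F E)) [MemTrivializationAtlas e] {V : Set B}
    (hV : V ⊆ e.baseSet) :
    (vecEmbed (ULift.{u} ℂ)).comp (vecSection hF s hs e hV) = modelSection hF s hs e hV := by
  ext b
  rw [ContinuousMap.comp_apply, modelSection_apply, vecEmbed_apply]
  simp_rw [vecSection_apply]

omit [FiniteDimensional ℂ F] in
/-- Off `p` the vector section is off the origin (inside the index domain). [folklore] -/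
theorem mapsTo_vecSection (e : Trivialization F (π F E)) [MemTrivializationAtlas e] {V : Set B}
    (hV : V ⊆ e.baseSet) {p : B} (hpV : p ∈ V) (hVU : V ⊆ indexDomain s p) :
    MapsTo (vecSection hF s hs e hV) ({(⟨p, hpV⟩ : ↥V)}ᶜ : Set ↥V) ({0}ᶜ : Set (ULift.{u} ℂ)) := by
  intro b hb
  have hb' : s b.1 ≠ 0 := by
    rcases hVU b.2 with h | h
    · exact absurd (Subtype.ext h) hb
    · exact h
  rw [mem_compl_iff, mem_singleton_iff, vecSection_apply]
  exact ((linEquivAt ℂ F E e b).trans (stdEquiv F hF)).map_ne_zero_iff.2 hb'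

/-- **The local index through the vector model**: for an atlas trivialisation `e` at the isolated
zero `p` and `V = U_e ∩ U_p`,

  `ind_p(s) = ⟨ω^rel_vec, (b ↦ e_b(s b))_* μ_p⟩`

— the relative Kronecker pairing in `(ℂ, ℂ ∖ 0)` (fixed line `ULift ℂ`) of Milnor–Stasheff's
preferred generator with the push-forward of the local orientation along the section read in the
trivialisation (McDuff–Salamon 2017, proof of Thm. 2.7.5: the multiplicity of a transverse zero is
the local degree `deg(s, p)` of `s : (U, U ∖ p) → (ℂ, ℂ ∖ 0)`). [cite: McDuffSalamon2017, Thm. 2.7.5] -/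
theorem localIndex_eq_vecSection [T2Space B] [ParacompactSpace B] (e : Trivialization F (π F E))
    [MemTrivializationAtlas e] (μ : HomologicalOrientation R B 2) (p : B) (hU : IsOpen (indexDomain s p))
    (hp : p ∈ e.baseSet) :
    localIndex hF R m s hs μ p =
      relKroneckerM R (ULift.{u} ℂ) ({0}ᶜ : Set (ULift.{u} ℂ)) 2 (omegaRelVec (ULift.{u} ℂ) finrank_model R R m)
        (relativeSingularHomology.map R R (vecSection hF s hs e (inter_subset_left (t := indexDomain s p)))
          (mapsTo_vecSection hF s hs e inter_subset_left ⟨hp, mem_indexDomain_self s p⟩ inter_subset_right) 2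
          ((localHomology.openSubsetIso R R (e.open_baseSet.inter hU) ⟨hp, mem_indexDomain_self s p⟩ 2).inv
            (μ.localClass p))) := by
  have hpV : p ∈ e.baseSet ∩ indexDomain s p := ⟨hp, mem_indexDomain_self s p⟩
  rw [localIndex_eq_trivialization hF R m s hs e μ p hU hp, ← relKroneckerM_map, omegaRelVec, ← ModuleCat.comp_apply,
    ← relSingularCohomology.map_comp,
    relSingularCohomology.map_congr (vecEmbed_comp_vecSection hF s hs e inter_subset_left) _
      (mapsTo_modelSection hF s hs e inter_subset_left hpV inter_subset_right) 2]

end Bundle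

end Literature.AlgebraicTopology.CharacteristicClasses
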